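import Mathlib
import Summits.Ventures.PercRepro2.Defs
import Summits.Ventures.PercRepro2.Graph
import Summits.Ventures.PercRepro2.OneColourSwitch
import Summits.Ventures.PercRepro2.RegionHubSign
import Summits.Ventures.PercRepro2.SideSwitch
import Summits.Ventures.PercRepro2.TermSwitchDefs
import Summits.Ventures.PercRepro2.TermSwitchFibre
import Summits.Ventures.PercRepro2.TermSwitchMono
import Summits.Ventures.PercRepro2.TermSwitchM9
import Summits.Ventures.PercRepro2.TermSwitchRestrict
import Summits.Ventures.PercRepro2.M9NoPocketDefs

/-!
# The unreached part of the single-`d` sum is non-positive (blind cell PercRepro2, p3 g24,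
2026-08-28; `proofs/P3-CONJG.md` §8)

For ANY non-mark `d`, the `Sep ∧ DOne` colourings in which `d` lies in neither world of `{r, s}`
are exactly the `Sep_H ∧ DZero_H` colourings of the terminal set `H = {r, s}` with `d` in the
outside `O_H` (`unreached_iff`); «`d` outside» is constant along the component assignments and
the outside flip of the `{r, s}`-switch (`OsetH_assignC`, `OsetH_flipIn`), so the restricted
terminal-set theorem gives `unreachedSum ≤ 0` (`unreachedSum_nonpos`) — the part `N` of the
status decomposition of `dSignSum` for a general `d`.  Own work; std axioms.
-/

namespace Summit.Ventures.PercRepro2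

namespace NoPocket

open Finset Classical RegionHub OneColourSwitch SideSwitch TermSwitch

variable {V : Type*} {E : Type*}

section Unreached

variable [Fintype V] [DecidableEq V] [Fintype E] [DecidableEq E] {ends : E → Sym2 V}
  {p q r s d : V}

omit [Fintype V] [DecidableEq V] [Fintype E] [DecidableEq E] in
/-- The `Y`-world of the terminal set `{r, s}` is `K₂`. -/
lemma KH_pair (ω : Config E) : KH ends ({r, s} : Set V) ω = K2 ends r s ω := rfl

omit [Fintype V] [DecidableEq V] [Fintype E] [DecidableEq E] in
/-- The `W`-world of the terminal set `{r, s}` is `M₂`. -/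
lemma MH_pair (ω : Config E) : MH ends ({r, s} : Set V) ω = M2 ends r s ω := rfl

omit [Fintype V] [DecidableEq V] [Fintype E] [DecidableEq E] in
/-- **`Sep ∧ DOne` with `d` unreached is `Sep_H ∧ DZero_H ∧ d ∈ O_H` for `H = {r, s}`.** -/
lemma unreached_iff (ω : Config E) :
    (sep2 ends p q r s ω ∧ DOne ends r s d ω ∧ d ∉ K2 ends r s ω ∧ d ∉ M2 ends r s ω) ↔
      (sepH ends p q ({r, s} : Set V) ω ∧ DZeroH ends ({r, s} : Set V) ω ∧
        d ∈ OsetH ends ({r, s} : Set V) ω) := by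
  constructor
  · rintro ⟨⟨⟨hpr, hps, hqr, hqs⟩, ⟨hpr', hps', hqr', hqs'⟩⟩, hD, hK, hM⟩
    refine ⟨⟨?_, ?_, ?_, ?_⟩, ?_, ?_⟩
    · rintro ⟨h, hh, hc⟩
      simp only [Set.mem_insert_iff, Set.mem_singleton_iff] at hh
      rcases hh with rfl | rfl
      · exact hpr (conn_symm hc)
      · exact hps (conn_symm hc)
    · rintro ⟨h, hh, hc⟩
      simp only [Set.mem_insert_iff, Set.mem_singleton_iff] at hh
      rcases hh with rfl | rfl
      · exact hqr (conn_symm hc)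
      · exact hqs (conn_symm hc)
    · rintro ⟨h, hh, hc⟩
      simp only [Set.mem_insert_iff, Set.mem_singleton_iff] at hh
      rcases hh with rfl | rfl
      · exact hpr' (conn_symm hc)
      · exact hps' (conn_symm hc)
    · rintro ⟨h, hh, hc⟩
      simp only [Set.mem_insert_iff, Set.mem_singleton_iff] at hh
      rcases hh with rfl | rfl
      · exact hqr' (conn_symm hc)
      · exact hqs' (conn_symm hc)
    · intro x hxH hxK hxM
      have hxr : x ≠ r := fun h => hxH (by rw [h]; simp)
      have hxs : x ≠ s := fun h => hxH (by rw [h]; simp)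
      have hxd : x ≠ d := by
        rintro rfl
        exact hK hxK
      exact hD x hxr hxs hxd hxK hxM
    · rintro (h | h)
      · exact hK h
      · exact hM h
  · rintro ⟨hsep, hD, hO⟩
    have hK : d ∉ K2 ends r s ω := fun h => hO (Or.inl h)
    have hM : d ∉ M2 ends r s ω := fun h => hO (Or.inr h)
    refine ⟨sep2_of_sepH (by simp) (by simp) hsep, ?_, hK, hM⟩
    intro x hxr hxs _ hxK
    have hxH : x ∉ ({r, s} : Set V) := by
      simp only [Set.mem_insert_iff, Set.mem_singleton_iff, not_or]
      exact ⟨hxr, hxs⟩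
    exact not_mem_both_of_DZeroH (by simp) (by simp) hD hxH hxK

/-- The unreached part of the single-`d` sum: `Σ_{Sep ∧ DOne ∧ d ∉ K₂ ∧ d ∉ M₂} σ_pq · σ_rs`. -/
noncomputable def unreachedSum (ends : E → Sym2 V) (p q r s d : V) : ℤ :=
  ∑ ω : Config E, if sep2 ends p q r s ω ∧ DOne ends r s d ω ∧ d ∉ K2 ends r s ω ∧
      d ∉ M2 ends r s ω then sigma ends ω p q * sigma ends ω r s else 0

/-- **The unreached part is non-positive**, for every non-mark `d`. -/
theorem unreachedSum_nonpos : unreachedSum ends p q r s d ≤ 0 := by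
  have h : unreachedSum ends p q r s d = dzeroSignSumHP ends p q r s ({r, s} : Set V)
      (fun ω => d ∈ OsetH ends ({r, s} : Set V) ω) := by
    unfold unreachedSum dzeroSignSumHP
    refine Finset.sum_congr rfl fun ω _ => ?_
    by_cases hc : sep2 ends p q r s ω ∧ DOne ends r s d ω ∧ d ∉ K2 ends r s ω ∧
        d ∉ M2 ends r s ω
    · rw [if_pos hc, if_pos ((unreached_iff ω).1 hc)]
    · rw [if_neg hc, if_neg (fun h => hc ((unreached_iff ω).2 h))]
  rw [h]
  refine dzeroSignSumHP_nonpos p q s (by simp) _ ?_ ?_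
  · intro ρ _ T hT
    rw [OsetH_assignC hT]
  · intro ρ _
    simp only [flipOH]
    rw [OsetH_flipIn]

end Unreached

end NoPocket

end Summit.Ventures.PercRepro2
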